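import Summits.MatrixMultiplication.OmegaCensus.ZetaCyclic

/-!
# ω-census, family (b3): conjecture C9 — 4-D HALF BLOCKS (phases mod 2) for `(ℤ[ζ₅]/p) ⋊ C₅`: independence and count

HONEST FRAMING (pub-omega census; verbatim): lottery ticket; floor = certified bounds/negative ranges.
Census BOOKKEEPING (conjecture C9 of the cell; pub-omega stpp-1 gen 22).  The 2-D phase-block layer of `EisPhaseBlocks` /
`QuadPhaseBlocks` with TWO changes: four coordinates (`re.re, re.im, im.re, im.im` of `ZetaRing p = 𝔽_p[θ][ζ]`, `co`) and phase
modulus `2` instead of `8` (cells are unions of trimmed products of HALF intervals `[φp/2, (φ+1)p/2)`, `φ ∈ {0,1}`, in each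
coordinate).  `PairOK2` (the pair condition of one coordinate: `2|E| < p`, `φ − φ' − Φ` odd, and the two one-sided trim clauses),
`no_conflict2` (from `PhaseArcs.no_conflict_core`), `coord_noConflict2`, `blockCells` / **`patIndep_blockCells`** (independent if
for every pair of columns / phase vectors SOME coordinate passes `PairOK2`), the explicit product arc set `blockArcSet ⊆ blockCells`
and its exact count **`card_blockArcSet`** `= Σ_c Σ_φ Π_k len_k` with `2·len ≥ p − lo − hi − 1` (`two_mul_bLen2_ge`).  With `α = A/2`
all errors are exact constants and all phases are `≡ error (mod 2)` for EVERY odd `p` — ONE pattern serves all primes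
(`ZetaCheck.lean`, `ZetaAll.lean`).  Nothing here is progress on `ω`.
-/

namespace Summit.MatrixMultiplication.OmegaCensus

open Finset

namespace ZetaArcs

variable {p : ℕ}

/-! ### One coordinate, modulus `2` -/

/-- The pair condition of one coordinate (phases mod `2`): `2|E| < p`, `φ − φ' − Φ` odd, and the one-sided trim clauses. [folklore] -/
def PairOK2 (p : ℕ) (Φ E φ φ' lo hi lo' hi' : ℤ) : Prop :=
  2 * |E| < p ∧ (φ - φ' - Φ) % 2 ≠ 0 ∧ (0 < E → E ≤ hi' ∨ E ≤ lo) ∧ (E < 0 → -E ≤ lo' ∨ -E ≤ hi)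

/-- `PairOK2` is decidable. [folklore] -/
instance (p : ℕ) (Φ E φ φ' lo hi lo' hi' : ℤ) : Decidable (PairOK2 p Φ E φ φ' lo hi lo' hi') := by
  unfold PairOK2; infer_instance

/-- **No conflict across two half-block cells** (coordinates form, modulus `2`; via `PhaseArcs.no_conflict_core`). [folklore] -/
theorem no_conflict2 {p φ φ' Φ j E lo hi lo' hi' A A' δ : ℤ} (hp : 0 < p)
    (hA : φ * p + lo ≤ 2 * A) (hA2 : 2 * A + hi < (φ + 1) * p)
    (hA' : φ' * p + lo' ≤ 2 * A') (hA'2 : 2 * A' + hi' < (φ' + 1) * p)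
    (hlo : 0 ≤ lo) (hhi : 0 ≤ hi) (hlo' : 0 ≤ lo') (hhi' : 0 ≤ hi')
    (hE : 2 * |E| < p) (hδ : 2 * δ = Φ * p + E) (hdiff : A - A' = δ + j * p)
    (h0 : (φ - φ' - Φ) % 2 ≠ 0) (hplus : 0 < E → E ≤ hi' ∨ E ≤ lo) (hminus : E < 0 → -E ≤ lo' ∨ -E ≤ hi) : False := by
  set r := 2 * A - φ * p with hr_def
  set r' := 2 * A' - φ' * p with hr'_def
  have hm : (φ - φ' - Φ - 2 * j) * p = E + r' - r := by
    rw [hr_def, hr'_def]; linear_combination hδ + 2 * hdiff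
  refine PhaseArcs.no_conflict_core (m := φ - φ' - Φ - 2 * j) hp (by linarith) (by linarith) (by linarith) (by linarith)
    hlo hhi hlo' hhi' hE hm ?_ ?_ ?_
  · intro h; apply h0; omega
  · intro _ hEpos; exact hplus hEpos
  · intro _ hEneg; exact hminus hEneg

/-- **One coordinate.** `A − A' = v₁ − v₂ + v₃ − v₄` in `ZMod p` with `2·v_k.val = a_k p + e_k`, `A`, `A'` in trimmed half blocks
`φ`, `φ'` whose `PairOK2` holds for `Φ = a₁ − a₂ + a₃ − a₄`, `E = e₁ − e₂ + e₃ − e₄`: absurd. [folklore] -/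
theorem coord_noConflict2 [NeZero p] {A A' v₁ v₂ v₃ v₄ : ZMod p} (heq : A - A' = v₁ - v₂ + v₃ - v₄)
    {a₁ a₂ a₃ a₄ e₁ e₂ e₃ e₄ : ℤ} (h₁ : 2 * (v₁.val : ℤ) = a₁ * p + e₁) (h₂ : 2 * (v₂.val : ℤ) = a₂ * p + e₂)
    (h₃ : 2 * (v₃.val : ℤ) = a₃ * p + e₃) (h₄ : 2 * (v₄.val : ℤ) = a₄ * p + e₄)
    {φ φ' lo hi lo' hi' : ℤ} (hlo : 0 ≤ lo) (hhi : 0 ≤ hi) (hlo' : 0 ≤ lo') (hhi' : 0 ≤ hi')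
    (hA : φ * p + lo ≤ 2 * (A.val : ℤ)) (hA2 : 2 * (A.val : ℤ) + hi < (φ + 1) * p)
    (hA' : φ' * p + lo' ≤ 2 * (A'.val : ℤ)) (hA'2 : 2 * (A'.val : ℤ) + hi' < (φ' + 1) * p)
    (hok : PairOK2 p (a₁ - a₂ + a₃ - a₄) (e₁ - e₂ + e₃ - e₄) φ φ' lo hi lo' hi') : False := by
  have hp : (0 : ℤ) < p := by have := NeZero.pos p; exact_mod_cast this
  obtain ⟨hE, h0, hplus, hminus⟩ := hok
  have hcast : (((A.val : ℤ) - A'.val - (v₁.val - v₂.val + v₃.val - v₄.val) : ℤ) : ZMod p) = 0 := by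
    push_cast
    simp only [ZMod.natCast_val, ZMod.cast_id', id_eq]
    linear_combination heq
  obtain ⟨j, hj⟩ := (ZMod.intCast_zmod_eq_zero_iff_dvd _ p).1 hcast
  have key : 2 * ((A.val : ℤ) - A'.val) = (a₁ - a₂ + a₃ - a₄ + 2 * j) * p + (e₁ - e₂ + e₃ - e₄) := by
    linear_combination 2 * hj + h₁ - h₂ + h₃ - h₄
  exact no_conflict2 (δ := (A.val : ℤ) - A'.val - j * p) (j := j) hp hA hA2 hA' hA'2 hlo hhi hlo' hhi' hE
    (by linear_combination key) (by ring) h0 hplus hminus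

/-! ### Four coordinates -/

/-- The `k`-th coordinate of an element of `𝔽_p[θ][ζ]` w.r.t. `1, θ, ζ, θζ`. [folklore] -/
def co (k : Fin 4) (z : ZetaRing p) : ZMod p :=
  match k with
  | 0 => z.re.re
  | 1 => z.re.im
  | 2 => z.im.re
  | 3 => z.im.im

/-- The `k`-th component of a `4`-tuple. [folklore] -/
def cmp {α : Type*} (k : Fin 4) (v : α × α × α × α) : α :=
  match k with
  | 0 => v.1
  | 1 => v.2.1
  | 2 => v.2.2.1
  | 3 => v.2.2.2

/-- Coordinates are additive: differences. [folklore] -/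
theorem co_sub (k : Fin 4) (z w : ZetaRing p) : co k (z - w) = co k z - co k w := by
  fin_cases k <;> simp [co]

/-- Coordinates are additive: sums. [folklore] -/
theorem co_add (k : Fin 4) (z w : ZetaRing p) : co k (z + w) = co k z + co k w := by
  fin_cases k <;> simp [co]

/-- Two `4`-tuples with all components equal are equal. [folklore] -/
theorem eq_of_cmp_eq {α : Type*} {v w : α × α × α × α} (h : ∀ k, cmp k v = cmp k w) : v = w := by
  have h0 := h 0; have h1 := h 1; have h2 := h 2; have h3 := h 3
  simp only [cmp] at h0 h1 h2 h3
  exact Prod.ext h0 (Prod.ext h1 (Prod.ext h2 h3))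

/-- Membership of one coordinate in a trimmed half block. [folklore] -/
def InBlk (p : ℕ) (φ : ℤ) (l h : ℕ) (v : ZMod p) : Prop :=
  φ * p + l ≤ 2 * (v.val : ℤ) ∧ 2 * (v.val : ℤ) + h < (φ + 1) * p

/-- `InBlk` is decidable. [folklore] -/
instance (p : ℕ) (φ : ℤ) (l h : ℕ) (v : ZMod p) : Decidable (InBlk p φ l h v) := by unfold InBlk; infer_instance

/-- The 4-D half-block cell set: `(c, V)` with every coordinate of `V` in its trimmed half block, for some `φ ∈ P c`. [folklore] -/
def blockCells (p : ℕ) [NeZero p] (P : Fin 3 × Fin 3 → Finset (ℤ × ℤ × ℤ × ℤ))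
    (lo hi : Fin 3 × Fin 3 → ℤ × ℤ × ℤ × ℤ → ℕ × ℕ × ℕ × ℕ) : Finset ((Fin 3 × Fin 3) × ZetaRing p) :=
  univ.filter fun x => ∃ φ ∈ P x.1, ∀ k : Fin 4, InBlk p (cmp k φ) (cmp k (lo x.1 φ)) (cmp k (hi x.1 φ)) (co k x.2)

/-- Membership in the block cell set. [folklore] -/
theorem mem_blockCells [NeZero p] {P : Fin 3 × Fin 3 → Finset (ℤ × ℤ × ℤ × ℤ)}
    {lo hi : Fin 3 × Fin 3 → ℤ × ℤ × ℤ × ℤ → ℕ × ℕ × ℕ × ℕ} {x : (Fin 3 × Fin 3) × ZetaRing p} :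
    x ∈ blockCells p P lo hi ↔ ∃ φ ∈ P x.1, ∀ k : Fin 4, InBlk p (cmp k φ) (cmp k (lo x.1 φ)) (cmp k (hi x.1 φ)) (co k x.2) := by
  simp only [blockCells, mem_filter, mem_univ, true_and]

/-- **4-D half blocks are independent** when every pair of columns / phase vectors passes `PairOK2` in SOME coordinate. [folklore] -/
theorem patIndep_blockCells [NeZero p] (D : RCyc.RBox (ZetaRing p) 5)
    (aα eα aβ eβ : Fin 4 → ZMod 5 → Fin 3 → ℤ)
    (hα : ∀ k s i, 2 * ((co k (RCyc.act QGold.gz s * D.α i)).val : ℤ) = aα k s i * p + eα k s i)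
    (hβ : ∀ k s j, 2 * ((co k (RCyc.act QGold.gz s * D.β j)).val : ℤ) = aβ k s j * p + eβ k s j)
    (P : Fin 3 × Fin 3 → Finset (ℤ × ℤ × ℤ × ℤ)) (lo hi : Fin 3 × Fin 3 → ℤ × ℤ × ℤ × ℤ → ℕ × ℕ × ℕ × ℕ)
    (hcond : ∀ c c', c ≠ c' → ∀ φ ∈ P c, ∀ φ' ∈ P c', ∃ k : Fin 4,
      PairOK2 p (EisArcs.PhiR D (aα k) (aβ k) c c') (EisArcs.PhiR D (eα k) (eβ k) c c') (cmp k φ) (cmp k φ')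
        ((cmp k (lo c φ) : ℕ) : ℤ) ((cmp k (hi c φ) : ℕ) : ℤ) ((cmp k (lo c' φ') : ℕ) : ℤ) ((cmp k (hi c' φ') : ℕ) : ℤ)) :
    D.PatIndep QGold.gz (blockCells p P lo hi) := by
  intro x hx y hy hxy heq
  obtain ⟨φ, hφ, hxk⟩ := mem_blockCells.1 hx
  obtain ⟨φ', hφ', hyk⟩ := mem_blockCells.1 hy
  by_cases hc : x.1 = y.1
  · rw [hc, RCyc.RBox.dd_self, sub_eq_zero] at heq
    exact hxy (Prod.ext hc heq)
  rw [RCyc.RBox.dd_eq_four] at heq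
  obtain ⟨k, hok⟩ := hcond x.1 y.1 hc φ hφ φ' hφ'
  have hk := congrArg (co k) heq
  rw [co_sub, co_sub, co_add, co_sub] at hk
  obtain ⟨hx1, hx2⟩ := hxk k
  obtain ⟨hy1, hy2⟩ := hyk k
  exact coord_noConflict2 hk (hα k _ y.1.1) (hβ k _ x.1.2) (hβ k _ y.1.2) (hα k _ x.1.1)
    (Nat.cast_nonneg _) (Nat.cast_nonneg _) (Nat.cast_nonneg _) (Nat.cast_nonneg _) hx1 hx2 hy1 hy2 hok

/-! ### The explicit product arc set and its count -/

/-- First index of the half arc of phase `φ` with bottom trim `l`: `⌈(φp + l)/2⌉`. [folklore] -/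
def bStart2 (p : ℕ) (φ : ℤ) (l : ℕ) : ℤ := (φ * p + l + 1) / 2

/-- Last index of the half arc of phase `φ` with top trim `h`: `⌊((φ+1)p − h − 1)/2⌋`. [folklore] -/
def bStop2 (p : ℕ) (φ : ℤ) (h : ℕ) : ℤ := ((φ + 1) * p - h - 1) / 2

/-- The arc length (as an integer). [folklore] -/
def bLen2 (p : ℕ) (φ : ℤ) (l h : ℕ) : ℤ := bStop2 p φ h + 1 - bStart2 p φ l

/-- Each half arc is long: `2·len ≥ p − l − h − 1`. [folklore] -/
theorem two_mul_bLen2_ge (φ : ℤ) (l h : ℕ) : (p : ℤ) - l - h - 1 ≤ 2 * bLen2 p φ l h := by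
  simp only [bLen2, bStart2, bStop2]
  have : (φ + 1) * (p : ℤ) = φ * p + p := by ring
  omega

/-- Bounds of an arc index. [folklore] -/
theorem b_bounds2 {φ : ℤ} {l h : ℕ} {n : ℤ} (hφ : 0 ≤ φ ∧ φ < 2) (hn : n ∈ Icc (bStart2 p φ l) (bStop2 p φ h)) :
    0 ≤ n ∧ n < p ∧ φ * p + l ≤ 2 * n ∧ 2 * n + h < (φ + 1) * p := by
  rw [mem_Icc, bStart2, bStop2] at hn
  obtain ⟨h1, h2⟩ := hn
  have hp0 : (0 : ℤ) ≤ p := by positivity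
  refine ⟨?_, ?_, by omega, by omega⟩
  · have : 0 ≤ φ * (p : ℤ) := mul_nonneg hφ.1 hp0
    omega
  · have : (φ + 1) * (p : ℤ) ≤ 2 * p := by nlinarith
    omega

/-- The index box of a block: the product of the four arcs. [folklore] -/
noncomputable def idxBox (p : ℕ) (φ : ℤ × ℤ × ℤ × ℤ) (l h : ℕ × ℕ × ℕ × ℕ) : Finset (ℤ × ℤ × ℤ × ℤ) :=
  Icc (bStart2 p φ.1 l.1) (bStop2 p φ.1 h.1) ×ˢ (Icc (bStart2 p φ.2.1 l.2.1) (bStop2 p φ.2.1 h.2.1) ×ˢ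
    (Icc (bStart2 p φ.2.2.1 l.2.2.1) (bStop2 p φ.2.2.1 h.2.2.1) ×ˢ Icc (bStart2 p φ.2.2.2 l.2.2.2) (bStop2 p φ.2.2.2 h.2.2.2)))

/-- The element of `𝔽_p[θ][ζ]` with integer coordinates `n`. [folklore] -/
def ofIdx (p : ℕ) (n : ℤ × ℤ × ℤ × ℤ) : ZetaRing p := ⟨⟨(n.1 : ZMod p), (n.2.1 : ZMod p)⟩, ⟨(n.2.2.1 : ZMod p), (n.2.2.2 : ZMod p)⟩⟩

/-- Coordinates of `ofIdx`. [folklore] -/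
theorem co_ofIdx (k : Fin 4) (n : ℤ × ℤ × ℤ × ℤ) : co k (ofIdx p n) = ((cmp k n : ℤ) : ZMod p) := by
  fin_cases k <;> rfl

/-- The number of cells of a block: the product of the four arc lengths. [folklore] -/
def blkCount (p : ℕ) (φ : ℤ × ℤ × ℤ × ℤ) (l h : ℕ × ℕ × ℕ × ℕ) : ℕ :=
  (bLen2 p φ.1 l.1 h.1).toNat * ((bLen2 p φ.2.1 l.2.1 h.2.1).toNat *
    ((bLen2 p φ.2.2.1 l.2.2.1 h.2.2.1).toNat * (bLen2 p φ.2.2.2 l.2.2.2 h.2.2.2).toNat))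

/-- The explicit arc set: column `c`, phase vector `φ ∈ P c`, elements with coordinates in the index box. [folklore] -/
noncomputable def blockArcSet (p : ℕ) [NeZero p] (P : Fin 3 × Fin 3 → Finset (ℤ × ℤ × ℤ × ℤ))
    (lo hi : Fin 3 × Fin 3 → ℤ × ℤ × ℤ × ℤ → ℕ × ℕ × ℕ × ℕ) : Finset ((Fin 3 × Fin 3) × ZetaRing p) :=
  (univ : Finset (Fin 3 × Fin 3)).biUnion fun c => (P c).biUnion fun φ =>
    (idxBox p φ (lo c φ) (hi c φ)).image fun n => (c, ofIdx p n)

section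

variable [NeZero p] {P : Fin 3 × Fin 3 → Finset (ℤ × ℤ × ℤ × ℤ)} {lo hi : Fin 3 × Fin 3 → ℤ × ℤ × ℤ × ℤ → ℕ × ℕ × ℕ × ℕ}
  (hP : ∀ c, ∀ φ ∈ P c, ∀ k, 0 ≤ cmp k φ ∧ cmp k φ < 2)
include hP

omit [NeZero p] in
/-- Index boxes: every index satisfies the bounds of its coordinate. [folklore] -/
theorem idx_bounds (c : Fin 3 × Fin 3) {φ : ℤ × ℤ × ℤ × ℤ} (hφ : φ ∈ P c) {n : ℤ × ℤ × ℤ × ℤ}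
    (hn : n ∈ idxBox p φ (lo c φ) (hi c φ)) (k : Fin 4) :
    0 ≤ cmp k n ∧ cmp k n < p ∧ cmp k φ * p + cmp k (lo c φ) ≤ 2 * cmp k n ∧
      2 * cmp k n + cmp k (hi c φ) < (cmp k φ + 1) * p := by
  simp only [idxBox, mem_product] at hn
  obtain ⟨h1, h2, h3, h4⟩ := hn
  fin_cases k
  · exact b_bounds2 (hP c φ hφ 0) h1
  · exact b_bounds2 (hP c φ hφ 1) h2
  · exact b_bounds2 (hP c φ hφ 2) h3
  · exact b_bounds2 (hP c φ hφ 3) h4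

/-- **The arc set lies in the block cell set.** [folklore] -/
theorem blockArcSet_subset : blockArcSet p P lo hi ⊆ blockCells p P lo hi := by
  intro x hx
  simp only [blockArcSet, mem_biUnion, mem_univ, true_and, mem_image] at hx
  obtain ⟨c, φ, hφ, n, hn, rfl⟩ := hx
  rw [mem_blockCells]
  refine ⟨φ, hφ, fun k => ?_⟩
  obtain ⟨h0, hp', h1, h2⟩ := idx_bounds hP c hφ hn k
  simp only [InBlk, co_ofIdx, PhaseArcs.val_cast_of_bounds h0 hp']
  exact ⟨h1, h2⟩

/-- The element map is injective on an index box. [folklore] -/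
theorem injOn_idxBox (c : Fin 3 × Fin 3) {φ : ℤ × ℤ × ℤ × ℤ} (hφ : φ ∈ P c) :
    Set.InjOn (fun n : ℤ × ℤ × ℤ × ℤ => (c, ofIdx p n)) (idxBox p φ (lo c φ) (hi c φ) : Set (ℤ × ℤ × ℤ × ℤ)) := by
  intro n hn n' hn' e
  rw [mem_coe] at hn hn'
  simp only [Prod.mk.injEq, true_and] at e
  refine eq_of_cmp_eq fun k => ?_
  have hb := idx_bounds hP c hφ hn k
  have hb' := idx_bounds hP c hφ hn' k
  have ek : co k (ofIdx p n) = co k (ofIdx p n') := by rw [e]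
  rw [co_ofIdx, co_ofIdx] at ek
  have e1 := congrArg (fun z : ZMod p => (z.val : ℤ)) ek
  simpa only [PhaseArcs.val_cast_of_bounds hb.1 hb.2.1, PhaseArcs.val_cast_of_bounds hb'.1 hb'.2.1] using e1

/-- **Exact count of the arc set**: `Σ_c Σ_{φ ∈ P c} Π_k len_k`. [folklore] -/
theorem card_blockArcSet : #(blockArcSet p P lo hi) = ∑ c, ∑ φ ∈ P c, blkCount p φ (lo c φ) (hi c φ) := by
  rw [blockArcSet, card_biUnion]
  · refine sum_congr rfl fun c _ => ?_
    rw [card_biUnion]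
    · refine sum_congr rfl fun φ hφ => ?_
      rw [card_image_of_injOn (injOn_idxBox hP c hφ), idxBox, card_product, card_product, card_product, Int.card_Icc,
        Int.card_Icc, Int.card_Icc, Int.card_Icc]
      rfl
    · -- blocks of distinct phase vectors in one column are disjoint
      intro φ hφ φ' hφ' hne
      rw [Function.onFun, disjoint_left]
      intro x hx hx'
      rw [mem_image] at hx hx'
      obtain ⟨n, hn, rfl⟩ := hx
      obtain ⟨n', hn', e⟩ := hx'
      simp only [Prod.mk.injEq, true_and] at e
      apply hne
      refine eq_of_cmp_eq fun k => ?_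
      have hb := idx_bounds hP c hφ hn k
      have hb' := idx_bounds hP c hφ' hn' k
      have ek : co k (ofIdx p n') = co k (ofIdx p n) := by rw [e]
      rw [co_ofIdx, co_ofIdx] at ek
      have e1 := congrArg (fun z : ZMod p => (z.val : ℤ)) ek
      simp only [PhaseArcs.val_cast_of_bounds hb.1 hb.2.1, PhaseArcs.val_cast_of_bounds hb'.1 hb'.2.1] at e1
      have hl := (hP c φ hφ k); have hl' := (hP c φ' hφ' k)
      have hp0 : (0 : ℤ) < p := by have := NeZero.pos p; exact_mod_cast this
      by_contra hne1
      rcases lt_or_gt_of_ne hne1 with hlt | hlt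
      · have : (cmp k φ + 1) * (p : ℤ) ≤ cmp k φ' * p := by nlinarith
        omega
      · have : (cmp k φ' + 1) * (p : ℤ) ≤ cmp k φ * p := by nlinarith
        omega
  · -- different columns give disjoint sets
    intro c _ c' _ hne
    rw [Function.onFun, disjoint_left]
    intro x hx hx'
    simp only [mem_biUnion, mem_image] at hx hx'
    obtain ⟨φ, -, n, -, rfl⟩ := hx
    obtain ⟨φ', -, n', -, e⟩ := hx'
    simp only [Prod.mk.injEq] at e
    exact hne e.1.symm

end

end ZetaArcs

end Summit.MatrixMultiplication.OmegaCensus
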